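import Summits.ResolutionOfSingularities.ResolutionOfSingularities.Theorems.WeightedInvariantELadderTwoMuAttained
import HarnessLib

/-!
# Rung `e = 2`, piece (C-b) `E2MaxClosedBody`: the maximum locus is relatively closed in the read points

Cell `res-hironaka`, line `L W4.3`, door crux `HypersurfaceCentreConstruction` (stmt-ResolutionOfSingularities-19897),
E2 tier; registrar res-L1-w43-plan-1, SPEC (Δ9) rev 3 piece (C-b) (SHARED with the step piece (S-c) via
`E2StepMaxBody_of_maxClosed`).  A forty-line COROLLARY of the graded chart reading of (C-a)
(`Stage.isClosed_superlevel_genSing₂`, …ELadderTwoMuAttained, res-D-pv-031): the superlevel set `{mu₂ ≤ iotaAt}` is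
closed in the subspace `genSing₂` and contains `maxLocus₂`, so it contains every read point of the closure of
`maxLocus₂`; with `iotaAt ≤ mu₂` on `genSing₂` such a point is in `maxLocus₂`.  OURS bookkeeping; nothing here is a
statement of [Hironaka2017]; AI-written, weaker than expert review.
-/

noncomputable section

set_option linter.dupNamespace false -- mandated namespace of this single-conjunct summit

open CategoryTheory AlgebraicGeometry TopologicalSpace Topology
open Literature.AlgebraicGeometry.Resolution
open Summit.ResolutionOfSingularities.ResolutionOfSingularities.Theorems
open Summit.ResolutionOfSingularities.ResolutionOfSingularities.Cruxes.HypersurfaceCentreConstruction.LocalEngine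

namespace Summit.ResolutionOfSingularities.ResolutionOfSingularities.Theorems.ELadderOne.Stage

variable {k : Type} [Field k] (S : Stage k) {p : ℕ} (ι : (R : Type) → [CommRing R] → R → Ordinal.{0})
  (J : (R : Type) → [CommRing R] → R → ℕ → Ideal R)

/-- **A read point in the closure of the maximum locus is in the maximum locus** (under the graded HOM rung and
(I0)₂). [folklore] -/
theorem mem_maxLocus₂_of_mem_closure [CharP k p] [PerfectField k] (hr : PRungGrHomLE 3 p ι J) (h0 : S.InvDim₂)
    {y : S.Y} (hy : y ∈ S.genSing₂) (hcl : y ∈ closure (S.maxLocus₂ ι)) : y ∈ S.maxLocus₂ ι := by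
  refine ⟨hy, le_antisymm (S.iotaAt_le_mu₂ ι hy) ?_⟩
  have hC := S.isClosed_superlevel_genSing₂ ι J hr h0 (S.mu₂ ι)
  -- in the subspace `genSing₂`, `y` lies in the closure of the trace of `maxLocus₂`
  have hmem : (⟨y, hy⟩ : {y : S.Y // y ∈ S.genSing₂}) ∈
      closure ((Subtype.val : {y : S.Y // y ∈ S.genSing₂} → S.Y) ⁻¹' S.maxLocus₂ ι) := by
    rw [IsInducing.subtypeVal.closure_eq_preimage_closure_image, Set.mem_preimage, Subtype.image_preimage_coe,
      Set.inter_eq_right.mpr (S.maxLocus₂_subset_genSing₂ ι)]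
    exact hcl
  -- the trace of `maxLocus₂` lies in the closed superlevel set `{mu₂ ≤ iotaAt}`
  have hsub : ((Subtype.val : {y : S.Y // y ∈ S.genSing₂} → S.Y) ⁻¹' S.maxLocus₂ ι) ⊆
      {z : {y : S.Y // y ∈ S.genSing₂} | S.mu₂ ι ≤ iotaAt ι S.i.ker z.1} := fun z hz => hz.2.ge
  exact hC.closure_subset_iff.mpr hsub hmem

end Summit.ResolutionOfSingularities.ResolutionOfSingularities.Theorems.ELadderOne.Stage

namespace Summit.ResolutionOfSingularities.ResolutionOfSingularities.Cruxes.HypersurfaceCentreConstruction.LocalEngine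

open Summit.ResolutionOfSingularities.ResolutionOfSingularities.Theorems.ELadderOne

/-- (C-b) **THE MAXIMUM LOCUS IS RELATIVELY CLOSED IN THE READ POINTS** (size M; SHARED by the centre (C1) and the step (S-c)): a read point in
the closure of `maxLocus₂ ι` is in `maxLocus₂ ι` ((c8-gr)≤3 at level `α := mu₂` on a unit chart `D(h) ∩ W a` graded by `awayPiece`, dimension
hypothesis by G-HT (o63); `iotaAt_le_mu₂`). [OURS · candidate · registrar SPEC (Δ9); proved below under the rung as `e2MaxClosed`] -/
def E2MaxClosedBody (p : ℕ) (ι : (R : Type) → [CommRing R] → R → Ordinal.{0}) : Prop :=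
  ∀ ⦃k : Type⦄ [Field k] [CharP k p] [PerfectField k] (S : Stage k), S.InvDim₂ → ¬ Scheme.IsRegular S.X →
    ∀ y ∈ S.genSing₂, y ∈ closure (S.maxLocus₂ ι) → y ∈ S.maxLocus₂ ι

/-- **(C-b) `E2MaxClosedBody p ι` UNDER THE GRADED HOM RUNG** (the `hb`/`hcb` input of `stub_e2_centre_h_of_pieces` /
`stub_e2_step_h_of_four'`). [OURS] -/
theorem e2MaxClosed (p : ℕ) (ι : (R : Type) → [CommRing R] → R → Ordinal.{0})
    (J : (R : Type) → [CommRing R] → R → ℕ → Ideal R) (hr : PRungGrHomLE 3 p ι J) : E2MaxClosedBody p ι :=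
  fun _ _ _ _ S h0 _ _ hy hcl => S.mem_maxLocus₂_of_mem_closure ι J hr h0 hy hcl

/-- The registrar's quantifier shape. [OURS] -/
theorem e2MaxClosed' : ∀ p : ℕ, p.Prime → ∀ (ι : (R : Type) → [CommRing R] → R → Ordinal.{0})
    (J : (R : Type) → [CommRing R] → R → ℕ → Ideal R), PRungGrHomLE 3 p ι J → E2MaxClosedBody p ι :=
  fun p _ ι J hr => e2MaxClosed p ι J hr

end Summit.ResolutionOfSingularities.ResolutionOfSingularities.Cruxes.HypersurfaceCentreConstruction.LocalEngine

end
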